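import Literature.AlgebraicGeometry.Motives.AbelianVarietyTorsionPointsCountProofs
import Literature.NumberTheory.DiophantineGeometry.AVGaloisModule
import HarnessLib

/-!
# Torsion points of an abelian variety over an algebraically closed `Ω ⊇ k̄` are `k̄`-rational
# (Serre–Tate 1968 §1 «`A_m` … in the group `A(K_s)` … on which `Gal(K_s/K)` acts continuously»; Mumford §6)

For an abelian variety `A` over `k`, `k̄ = AlgebraicClosure k`, and an algebraically closed field `Ω`
containing `k̄` (`[Algebra k̄ Ω] [IsScalarTower k k̄ Ω]`; e.g. `Ω = ℂ` along an embedding `k̄ → ℂ`):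

* `exists_extendScalars_eq_of_mem_torsionPoints` — **every `n`-torsion point of `A(Ω)` is the extension
  of scalars (`AlgPoints.extendScalars`, injective) of an `n`-torsion point of `A(k̄)`**, `n` invertible in
  `k`: the injection `A[n](k̄) ↪ A[n](Ω)` is a bijection of finite sets of the same size `|n|^{2 dim A}`
  (the tree's discharged count `natCard_torsionPoints_of_isAlgClosed_holds`,
  `Motives/AbelianVarietyTorsionPointsCountProofs`, applied to BOTH algebraically closed fields);
* `smul_eq_of_restricts_of_mem_torsionPoints` — hence the action of `Aut(Ω/k)` on `A(Ω)_tors` is read on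
  `A[n](k̄)` through restriction (`AlgPoints.smul_extendScalars`): `σ • P = P` whenever `σ` restricts to a
  `γ ∈ Gal(k̄/k)` fixing `A[n](k̄)` — and those `γ` form an OPEN subgroup (`isOpen_torsionFixingSubgroup`,
  `Motives/AbelianVarietyDivisionField`).  This is the «open stabilisers» input of Shimura's descent
  argument for Thm. 21.4 (cell `hodgecm-mathlib`, line `a2b`, stub `stub_finiteLevelReciprocity`: the
  `Aut(ℂ/k₁)`-action on the torsion of `A₁(ℂ)` factors continuously through `Gal(k̄₁/k₁)`).

Everything is proved; no definition, no named fact.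

## References

* [SerreTate1968] J.-P. Serre, J. Tate, *Good reduction of abelian varieties*, Ann. of Math. 88 (1968), §1 p. 493.
* [MumfordAV1970] D. Mumford, *Abelian Varieties* (1970), §6 Application 3, Proposition p. 64.
* [Hartshorne1977] R. Hartshorne, *Algebraic Geometry*, II Ex. 2.7, Ex. 4.7.
-/

noncomputable section

open CategoryTheory Function

universe u

namespace Literature.AlgebraicGeometry.Motives.AbelianVariety

open scoped MonObj

variable {k : Type u} [Field k] (A : AbelianVariety k)


/-! ### Torsion points over `Ω ⊇ k̄` come from `k̄` -/

section Rational

variable (Ω : Type u) [Field Ω] [Algebra k Ω] [Algebra (AlgebraicClosure k) Ω]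
  [IsScalarTower k (AlgebraicClosure k) Ω] [IsAlgClosed Ω]

omit [IsAlgClosed Ω] in
/-- Extension of scalars `A(k̄) → A(Ω)` maps `n`-torsion to `n`-torsion (it is a homomorphism).
[cite: SerreTate1968, §1 p. 493] -/
theorem extendScalars_mem_torsionPoints {n : ℤ} {Q : A.Points (AlgebraicClosure k)}
    (hQ : Q ∈ A.torsionPoints (AlgebraicClosure k) n) :
    AlgPoints.extendScalars A.X (AlgebraicClosure k) Ω Q ∈ A.torsionPoints Ω n := by
  rw [mem_torsionPoints_iff] at hQ ⊢
  rw [← AlgPoints.extendScalarsMonoidHom_apply, ← map_zpow, hQ, map_one]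

/-- **Every torsion point of `A(Ω)` is `k̄`-rational** («`A_m ⊂ A(K_s)`», Serre–Tate §1): for `Ω`
algebraically closed over `k̄` and `n` invertible in `k`, each `P ∈ A[n](Ω)` is `extendScalars Q` for a
(unique, `AlgPoints.extendScalars_injective`) `Q ∈ A[n](k̄)` — the injection `A[n](k̄) ↪ A[n](Ω)` is a
bijection of finite sets of equal size `|n|^{2 dim A}`. [cite: SerreTate1968, §1 p. 493] [cite: MumfordAV1970, §6 Proposition p. 64] -/
theorem exists_extendScalars_eq_of_mem_torsionPoints {n : ℤ} (hn : (n : k) ≠ 0) {P : A.Points Ω}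
    (hP : P ∈ A.torsionPoints Ω n) :
    ∃ Q ∈ A.torsionPoints (AlgebraicClosure k) n, AlgPoints.extendScalars A.X (AlgebraicClosure k) Ω Q = P := by
  -- the restricted map `A[n](k̄) → A[n](Ω)`
  let f : A.torsionPoints (AlgebraicClosure k) n → A.torsionPoints Ω n :=
    fun Q ↦ ⟨AlgPoints.extendScalars A.X (AlgebraicClosure k) Ω Q, A.extendScalars_mem_torsionPoints Ω Q.2⟩
  have hf : Injective f := fun Q Q' h ↦
    Subtype.ext (AlgPoints.extendScalars_injective A.X (AlgebraicClosure k) Ω (congrArg Subtype.val h))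
  haveI : Finite (A.torsionPoints Ω n) := by
    apply Nat.finite_of_card_ne_zero
    rw [A.natCard_torsionPoints_eq_of_isAlgClosed Ω n hn]
    refine pow_ne_zero _ (Int.natAbs_ne_zero.mpr ?_)
    rintro rfl
    exact hn (by simp)
  have hcard : Nat.card (A.torsionPoints Ω n) ≤ Nat.card (A.torsionPoints (AlgebraicClosure k) n) := by
    rw [A.natCard_torsionPoints_eq_of_isAlgClosed Ω n hn,
      A.natCard_torsionPoints_eq_of_isAlgClosed (AlgebraicClosure k) n hn]
  obtain ⟨Q, hQ⟩ := (hf.bijective_of_nat_card_le hcard).2 ⟨P, hP⟩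
  exact ⟨Q, Q.2, congrArg Subtype.val hQ⟩

/-- **The action of `Aut(Ω/k)` on torsion points of `A(Ω)` is read on `A[n](k̄)`**: if `σ ∈ Aut(Ω/k)`
restricts along `k̄ → Ω` to `γ ∈ Gal(k̄/k)`, then for `P = Q_Ω ∈ A[n](Ω)` one has `σ • P = (γ • Q)_Ω`
(`AlgPoints.smul_extendScalars`); in particular `σ` fixes `P` as soon as `γ` fixes `Q`, e.g. for `γ` in the
OPEN subgroup `Gal(k̄/k(A[n]))` (`isOpen_torsionFixingSubgroup`). [cite: SerreTate1968, §1 p. 493 («Gal(K_s/K) acts continuously» on A_m)] -/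
theorem smul_eq_of_restricts_of_mem_torsionPoints {n : ℤ} (hn : (n : k) ≠ 0) (σ : Ω ≃ₐ[k] Ω)
    (g : AlgebraicClosure k ≃ₐ[k] AlgebraicClosure k)
    (hσg : ∀ x, σ (algebraMap (AlgebraicClosure k) Ω x) = algebraMap (AlgebraicClosure k) Ω (g x))
    {P : A.Points Ω} (hP : P ∈ A.torsionPoints Ω n)
    (hg : ∀ Q ∈ A.torsionPoints (AlgebraicClosure k) n, g • Q = Q) : σ • P = P := by
  obtain ⟨Q, hQ, rfl⟩ := A.exists_extendScalars_eq_of_mem_torsionPoints Ω hn hP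
  rw [AlgPoints.smul_extendScalars A.X g σ hσg, hg Q hQ]

end Rational

end Literature.AlgebraicGeometry.Motives.AbelianVariety

end
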